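import Literature.Probability.Percolation.ArmSeparationInwardExt
import HarnessLib

/-!
# The landed well-separated two-arm event has probability bounded below at bounded ratio

Topic: Probability / Percolation; family `crit-perc` (critical site percolation on `𝕋`,
`P = P_{1/2} = triSitePercolation half`). A brick of the discharge of
`Literature.Probability.Percolation.Nolin2008_twoArm_separation` (Nolin 2008, Thm. 11
[arXiv 0711.4948: Thm. 10], `j = 2`, `σ = BW`; `ArmSeparation.lean`): the initial estimate
`c ≤ h (k+1)` of the multi-scale scheme (`ArmSeparationScheme.lean`), i.e. an RSW lower bound for
the landed well-separated two-arm event `sepTwoArm m N` of `ArmSeparation.lean` when the ratio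
`N / m` is bounded:

  `P(sepTwoArm m N) ≥ c_init > 0`  for `1100 ≤ m`, `2m ≤ N ≤ 5m`

(Nolin 2008, Prop. 14 [arXiv Prop. 13], lower bound: "The lower bound comes from iterating item
(i)" of Prop. 12 — at bounded ratio a single explicit RSW construction). The open arm with its two
free spaces is realised by five open crossings (`sepInitArm m N`: the thinned inner free space at
`z' = (m, -m/2)` crossed vertically, a horizontal box to the column band `[N - N/8, N - 1]`, that
band crossed vertically, a horizontal box through `∂Λ_N` into the outer free space at
`z = (N, -N/2)`, the thinned outer free space crossed vertically; consecutive crossings meet,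
`exists_mem_of_cross`, `PathIn.relay`), all in the right half-plane; the closed arm landing on the
left is the image under `negFlip`, independent of the open one (disjoint supports), and `P_{1/2}`
is `negFlip`-invariant, so `P(sepTwoArm m N) ≥ P(sepInitArm m N)² ≥ c₅₁₂^{10}` by Harris' inequality.

## References

* P. Nolin, *Near-critical percolation in two dimensions*, Electron. J. Probab. 13 (2008), §4.3,
  Prop. 12 (i) and Prop. 14 (lower bound) [arXiv 0711.4948: Prop. 11, Prop. 13]. [Nolin2008]
* H. Kesten, *Scaling relations for 2D-percolation*, Comm. Math. Phys. 109 (1987), Lemma 2. [Kesten1987]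

Tree: `sepOpenArm`, `sepTwoArm`, fences and regions (`ArmSeparation.lean`); `mk_mem_sepLanding`,
`sepInCorrFence_subset_sepInnerFence` (`ArmSeparationInwardExt.lean`); `PathIn.relay` (`ArmSeparationGlue.lean`);
`exists_mem_of_cross` (`ArmEventsAPriori.lean`); `DeterminedBy.preimage_negFlip`,
`triSitePercolation_real_preimage_negFlip` (`ArmSeparationProofs.lean`); `sitePercolation_harris`,
`sitePercolation_real_inter_of_disjoint` (`SitePercolationMeasure.lean`); `tri_rsw_half_holds`.
-/

noncomputable section

open MeasureTheory Set

namespace Literature.Probability.Percolation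

open LatticeModels

/-! ### The explicit open arm -/

/-- **The explicit fenced open arm at bounded ratio** (all crossings open, all boxes in the right
half-plane): (i) the thinned inner free space `[m - m/8 + 1, m - 1] × [-m/2 - m/64, -m/2 + m/64]`
crossed vertically; (ii) `[m - m/8 + 1, N - 1] × [-m/2, -m/2 + m/64]` crossed horizontally; (iii)
the band `[N - N/8, N - 1] × [-N/2 - N/64, -m/2 + m/64]` crossed vertically; (iv)
`[N - N/8, N + N/8 - 1] × [-N/2 - N/64 + 1, -N/2]` crossed horizontally; (v) the thinned outer free
space `[N + 2, N + N/8 - 1] × [-N/2 - N/64, -N/2 + N/64]` crossed vertically. [cite: Nolin2008, §4.3 Prop. 12 (proof) and Prop. 14 (arXiv 0711.4948: Prop. 11, 13)] -/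
def sepInitArm (m N : ℕ) : Set (SiteConfig (Site 2)) :=
  triVCross ((m : ℤ) - (m / 8 : ℕ) + 1) (-((m / 2 : ℕ) : ℤ) - (m / 64 : ℕ)) (m / 8 - 2) (2 * (m / 64)) ∩
    triHCross ((m : ℤ) - (m / 8 : ℕ) + 1) (-((m / 2 : ℕ) : ℤ)) (N - m + m / 8 - 2) (m / 64) ∩
    triVCross ((N : ℤ) - (N / 8 : ℕ)) (-((N / 2 : ℕ) : ℤ) - (N / 64 : ℕ)) (N / 8 - 1) (N / 2 + N / 64 - m / 2 + m / 64) ∩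
    triHCross ((N : ℤ) - (N / 8 : ℕ)) (-((N / 2 : ℕ) : ℤ) - (N / 64 : ℕ) + 1) (2 * (N / 8) - 1) (N / 64 - 1) ∩
    triVCross ((N : ℤ) + 2) (-((N / 2 : ℕ) : ℤ) - (N / 64 : ℕ)) (N / 8 - 3) (2 * (N / 64))

/-- The sites of the five boxes of `sepInitArm`. [folklore] -/
def sepInitArmFinset (m N : ℕ) : Finset (Site 2) :=
  triStripFinset ((m : ℤ) - (m / 8 : ℕ) + 1) (-((m / 2 : ℕ) : ℤ) - (m / 64 : ℕ)) (m / 8 - 2) (2 * (m / 64)) ∪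
    triStripFinset ((m : ℤ) - (m / 8 : ℕ) + 1) (-((m / 2 : ℕ) : ℤ)) (N - m + m / 8 - 2) (m / 64) ∪
    triStripFinset ((N : ℤ) - (N / 8 : ℕ)) (-((N / 2 : ℕ) : ℤ) - (N / 64 : ℕ)) (N / 8 - 1) (N / 2 + N / 64 - m / 2 + m / 64) ∪
    triStripFinset ((N : ℤ) - (N / 8 : ℕ)) (-((N / 2 : ℕ) : ℤ) - (N / 64 : ℕ) + 1) (2 * (N / 8) - 1) (N / 64 - 1) ∪
    triStripFinset ((N : ℤ) + 2) (-((N / 2 : ℕ) : ℤ) - (N / 64 : ℕ)) (N / 8 - 3) (2 * (N / 64))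

/-- `sepInitArm` is increasing. [folklore] -/
theorem isUpperSet_sepInitArm (m N : ℕ) : IsUpperSet (sepInitArm m N) :=
  ((((isUpperSet_triVCross _ _ _ _).inter (isUpperSet_triHCross _ _ _ _)).inter (isUpperSet_triVCross _ _ _ _)).inter
    (isUpperSet_triHCross _ _ _ _)).inter (isUpperSet_triVCross _ _ _ _)

/-- `sepInitArm` is determined by the sites of its boxes. [folklore] -/
theorem determinedBy_sepInitArm (m N : ℕ) : DeterminedBy (sepInitArm m N) ↑(sepInitArmFinset m N) := by
  refine ((((((determinedBy_triVCross _ _ _ _).mono ?_).inter ((determinedBy_triHCross _ _ _ _).mono ?_)).inter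
    ((determinedBy_triVCross _ _ _ _).mono ?_)).inter ((determinedBy_triHCross _ _ _ _).mono ?_)).inter
    ((determinedBy_triVCross _ _ _ _).mono ?_))
  · exact Finset.coe_subset.2 (Finset.subset_union_left.trans (Finset.subset_union_left.trans
      (Finset.subset_union_left.trans Finset.subset_union_left)))
  · exact Finset.coe_subset.2 (Finset.subset_union_right.trans (Finset.subset_union_left.trans
      (Finset.subset_union_left.trans Finset.subset_union_left)))
  · exact Finset.coe_subset.2 (Finset.subset_union_right.trans (Finset.subset_union_left.trans Finset.subset_union_left))
  · exact Finset.coe_subset.2 (Finset.subset_union_right.trans Finset.subset_union_left)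
  · exact Finset.coe_subset.2 Finset.subset_union_right

/-- The boxes of `sepInitArm` lie in the right half-plane `{x₀ > 0}` (`16 ≤ m`). [folklore] -/
theorem sepInitArmFinset_pos {m N : ℕ} (hm : 16 ≤ m) (hmN : 2 * m ≤ N) {v : Site 2} (hv : v ∈ sepInitArmFinset m N) : 0 < v 0 := by
  simp only [sepInitArmFinset, Finset.mem_union] at hv
  rcases hv with (((hv | hv) | hv) | hv) | hv <;>
    rw [← Finset.mem_coe, coe_triStripFinset, mem_triStrip] at hv <;> omega

/-! ### The deterministic inclusion -/

section Det

variable {m N : ℕ}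

/-- Casting the width of the first horizontal box. [folklore] -/
theorem cast_sepInitArm_width (hm : 16 ≤ m) (hmN : 2 * m ≤ N) :
    ((N - m + m / 8 - 2 : ℕ) : ℤ) = (N : ℤ) - m + (m / 8 : ℕ) - 2 := by
  have h1 : m ≤ N := by omega
  have h2 : 2 ≤ N - m + m / 8 := by omega
  rw [Nat.cast_sub h2, Nat.cast_add, Nat.cast_sub h1]
  push_cast
  ring

/-- Casting the height of the connector band. [folklore] -/
theorem cast_sepInitArm_height (hmN : 2 * m ≤ N) :
    ((N / 2 + N / 64 - m / 2 + m / 64 : ℕ) : ℤ) = ((N / 2 : ℕ) : ℤ) + (N / 64 : ℕ) - (m / 2 : ℕ) + (m / 64 : ℕ) := by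
  omega

/-- The first horizontal box lies in the arm region: inside `Λ̊_m` in the inner attaching ball,
otherwise in the annulus (`64 ≤ m`, `2m ≤ N`). [cite: Nolin2008, §4.2 Def. 6–7 (arXiv 0711.4948)] -/
theorem sepInitArmHBox₁_subset (hm : 64 ≤ m) (hmN : 2 * m ≤ N) (z : Site 2) :
    triStrip ((m : ℤ) - (m / 8 : ℕ) + 1) (-((m / 2 : ℕ) : ℤ)) (N - m + m / 8 - 2) (m / 64) ⊆
      sepJoinRegion m N z ![(m : ℤ), -((m / 2 : ℕ) : ℤ)] := by
  intro v hv
  rw [mem_triStrip, cast_sepInitArm_width (by omega) hmN] at hv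
  rcases le_or_gt (m : ℤ) (v 0) with h0 | h0
  · refine Or.inl (Or.inl ⟨le_triNorm_iff_lin.2 (Or.inl h0), triNorm_le_iff_lin.2 ?_⟩)
    omega
  · refine Or.inr ?_
    rw [mem_triOpenBall, triNorm_lt_iff_lin]
    simp only [Pi.sub_apply, site_mk_apply_zero, site_mk_apply_one]
    omega

/-- The connector band lies in the annulus `{m ≤ |v| ≤ N}` (`2m ≤ N`, `64 ≤ m`). [folklore] -/
theorem sepInitArmVBox_subset (hm : 64 ≤ m) (hmN : 2 * m ≤ N) :
    triStrip ((N : ℤ) - (N / 8 : ℕ)) (-((N / 2 : ℕ) : ℤ) - (N / 64 : ℕ)) (N / 8 - 1) (N / 2 + N / 64 - m / 2 + m / 64) ⊆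
      triAnnulusSet m N := by
  intro v hv
  rw [mem_triStrip, cast_sepInitArm_height hmN] at hv
  have e : ((N / 8 - 1 : ℕ) : ℤ) = (N / 8 : ℕ) - 1 := by omega
  rw [e] at hv
  exact ⟨le_triNorm_iff_lin.2 (Or.inl (by omega)), triNorm_le_iff_lin.2 (by omega)⟩

/-- The second horizontal box lies in the arm region: inside `Λ_N` in the annulus, beyond in the
outer attaching ball (`64 ≤ m`, `2m ≤ N`). [cite: Nolin2008, §4.2 Def. 6 (arXiv 0711.4948)] -/
theorem sepInitArmHBox₂_subset (hm : 64 ≤ m) (hmN : 2 * m ≤ N) (z' : Site 2) :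
    triStrip ((N : ℤ) - (N / 8 : ℕ)) (-((N / 2 : ℕ) : ℤ) - (N / 64 : ℕ) + 1) (2 * (N / 8) - 1) (N / 64 - 1) ⊆
      sepJoinRegion m N ![(N : ℤ), -((N / 2 : ℕ) : ℤ)] z' := by
  intro v hv
  rw [mem_triStrip] at hv
  have e : ((2 * (N / 8) - 1 : ℕ) : ℤ) = 2 * (N / 8 : ℕ) - 1 := by omega
  have e' : ((N / 64 - 1 : ℕ) : ℤ) = (N / 64 : ℕ) - 1 := by omega
  rw [e, e'] at hv
  rcases le_or_gt (v 0) (N : ℤ) with h0 | h0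
  · refine Or.inl (Or.inl ⟨le_triNorm_iff_lin.2 (Or.inl (by omega)), triNorm_le_iff_lin.2 ?_⟩)
    omega
  · refine Or.inl (Or.inr ?_)
    rw [mem_triOpenBall, triNorm_lt_iff_lin]
    simp only [Pi.sub_apply, site_mk_apply_zero, site_mk_apply_one]
    omega

/-- The thinned outer free space lies in the outer free space `sepOuterFence N z`,
`z = (N, -N/2)` (`64 ≤ N`). [folklore] -/
theorem sepInitArmFence_subset_sepOuterFence (hN : 64 ≤ N) :
    triStrip ((N : ℤ) + 2) (-((N / 2 : ℕ) : ℤ) - (N / 64 : ℕ)) (N / 8 - 3) (2 * (N / 64)) ⊆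
      sepOuterFence N ![(N : ℤ), -((N / 2 : ℕ) : ℤ)] := by
  intro v hv
  rw [mem_triStrip] at hv
  rw [mem_sepOuterFence, site_mk_apply_one]
  have e : ((N / 8 - 3 : ℕ) : ℤ) = (N / 8 : ℕ) - 3 := by omega
  rw [e] at hv
  simp only [Nat.cast_mul, Nat.cast_ofNat] at hv
  omega

/-- **The explicit arm is a fenced open arm**: `sepInitArm m N ⊆ sepOpenArm m N` for `1100 ≤ m`,
`2m ≤ N` (the five crossings are glued at their common boxes and the path is read inside the arm
region `sepJoinRegion m N z z'`). [cite: Nolin2008, §4.3 Prop. 12 (proof) and Prop. 14 (arXiv 0711.4948: Prop. 11, 13)] -/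
theorem sepInitArm_subset_sepOpenArm (hm : 1100 ≤ m) (hmN : 2 * m ≤ N) : sepInitArm m N ⊆ sepOpenArm m N := by
  rintro ω ⟨⟨⟨⟨hE1, hE2⟩, hE3⟩, hE4⟩, hE5⟩
  set z : Site 2 := ![(N : ℤ), -((N / 2 : ℕ) : ℤ)] with hz
  set z' : Site 2 := ![(m : ℤ), -((m / 2 : ℕ) : ℤ)] with hz'
  have hz1 : z 1 = -((N / 2 : ℕ) : ℤ) := site_mk_apply_one _ _
  have hz'1 : z' 1 = -((m / 2 : ℕ) : ℤ) := site_mk_apply_one _ _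
  obtain ⟨b₁, t₁, hb₁, ht₁, P1⟩ := hE1
  obtain ⟨a₂, e₂, ha₂, he₂, P2⟩ := hE2
  obtain ⟨b₃, t₃, hb₃, ht₃, P3⟩ := hE3
  obtain ⟨a₄, e₄, ha₄, he₄, P4⟩ := hE4
  obtain ⟨b₅, t₅, hb₅, ht₅, P5⟩ := hE5
  rw [cast_sepInitArm_width (by omega) hmN] at he₂
  rw [cast_sepInitArm_height hmN] at ht₃
  have e4 : ((2 * (N / 8) - 1 : ℕ) : ℤ) = 2 * (N / 8 : ℕ) - 1 := by omega
  have e4' : ((N / 64 - 1 : ℕ) : ℤ) = (N / 64 : ℕ) - 1 := by omega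
  have e5 : ((N / 8 - 3 : ℕ) : ℤ) = (N / 8 : ℕ) - 3 := by omega
  have e1 : ((m / 8 - 2 : ℕ) : ℤ) = (m / 8 : ℕ) - 2 := by omega
  have e3 : ((N / 8 - 1 : ℕ) : ℤ) = (N / 8 : ℕ) - 1 := by omega
  rw [e4] at he₄
  simp only [Nat.cast_mul, Nat.cast_ofNat] at ht₁ ht₅
  -- the inner attaching site `u`: the crossing of the inner free space meets the first box
  obtain ⟨S1, hS1, P1', T1⟩ := P1.exists_support
  obtain ⟨S2, hS2, P2', T2⟩ := P2.exists_support
  obtain ⟨u, huS2, huS1⟩ := exists_mem_of_cross (L := (m : ℤ) - (m / 8 : ℕ) + 1) (R := (m : ℤ) - 1)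
    (B := -((m / 2 : ℕ) : ℤ) - (m / 64 : ℕ)) (T := -((m / 2 : ℕ) : ℤ) + (m / 64 : ℕ)) (by omega) (by omega)
    P2' ha₂.le (by omega)
    (fun v hv _ _ => by have h := (hS2 hv).1; rw [mem_triStrip] at h; omega)
    P1' hb₁.le (by omega)
    (fun v hv _ _ => by have h := (hS1 hv).1; rw [mem_triStrip, e1] at h; omega)
  -- the outer attaching site `u'`: the second box meets the crossing of the outer free space
  obtain ⟨S4, hS4, P4', T4⟩ := P4.exists_support
  obtain ⟨S5, hS5, P5', T5⟩ := P5.exists_support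
  obtain ⟨u', huS4, huS5⟩ := exists_mem_of_cross (L := (N : ℤ) + 2) (R := (N : ℤ) + (N / 8 : ℕ) - 1)
    (B := -((N / 2 : ℕ) : ℤ) - (N / 64 : ℕ)) (T := -((N / 2 : ℕ) : ℤ) + (N / 64 : ℕ)) (by omega) (by omega)
    P4' (by omega) (by omega)
    (fun v hv _ _ => by have h := (hS4 hv).1; rw [mem_triStrip, e4, e4'] at h; omega)
    P5' hb₅.le (by omega)
    (fun v hv _ _ => by have h := (hS5 hv).1; rw [mem_triStrip, e5] at h; omega)
  -- the two free spaces are crossed through `u`, `u'`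
  have hS1F : S1 ⊆ sepInnerFence m z' ∩ ω := fun v hv => ⟨sepInCorrFence_subset_sepInnerFence (by omega) (hS1 hv).1, (hS1 hv).2⟩
  have hS5F : S5 ⊆ sepOuterFence N z ∩ ω := fun v hv => ⟨sepInitArmFence_subset_sepOuterFence (by omega) (hS5 hv).1, (hS5 hv).2⟩
  have hIn : OpenVCrossThrough (sepInnerFence m z') (z' 1 - (m / 64 : ℕ)) (z' 1 + (m / 64 : ℕ)) ω u :=
    ⟨b₁, t₁, by rw [hz'1, hb₁], by rw [hz'1, ht₁]; ring, (T1 u huS1).mono hS1F,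
      ((T1 u huS1).symm.trans (T1 t₁ P1'.right_mem)).mono hS1F⟩
  have hOut : OpenVCrossThrough (sepOuterFence N z) (z 1 - (N / 64 : ℕ)) (z 1 + (N / 64 : ℕ)) ω u' :=
    ⟨b₅, t₅, by rw [hz1, hb₅], by rw [hz1, ht₅]; ring, (T5 u' huS5).mono hS5F,
      ((T5 u' huS5).symm.trans (T5 t₅ P5'.right_mem)).mono hS5F⟩
  -- relays through the connector band
  have Q2 := PathIn.relay (L := (N : ℤ) - (N / 8 : ℕ)) (R := (N : ℤ) - 1)
    (B := -((N / 2 : ℕ) : ℤ) - (N / 64 : ℕ)) (T := -((m / 2 : ℕ) : ℤ) + (m / 64 : ℕ)) (by omega) (by omega)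
    P2 (by omega) (by omega) (fun v hv _ _ => by rw [mem_triStrip] at hv; omega)
    P3 hb₃.le (by omega) (fun v hv _ _ => by rw [mem_triStrip, e3] at hv; omega)
  have Q4 := PathIn.relay (L := (N : ℤ) - (N / 8 : ℕ)) (R := (N : ℤ) - 1)
    (B := -((N / 2 : ℕ) : ℤ) - (N / 64 : ℕ)) (T := -((m / 2 : ℕ) : ℤ) + (m / 64 : ℕ)) (by omega) (by omega)
    P4 ha₄.le (by omega) (fun v hv _ _ => by rw [mem_triStrip, e4, e4'] at hv; omega)
    P3 hb₃.le (by omega) (fun v hv _ _ => by rw [mem_triStrip, e3] at hv; omega)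
  -- regions
  have R2 := sepInitArmHBox₁_subset (N := N) (by omega) hmN z
  have R3 := sepInitArmVBox_subset (N := N) (by omega : 64 ≤ m) hmN
  have R4 := sepInitArmHBox₂_subset (N := N) (by omega : 64 ≤ m) hmN z'
  have hann : triAnnulusSet m N ⊆ sepJoinRegion m N z z' := fun v hv => Or.inl (Or.inl hv)
  have W1 : PathIn triGraph (sepJoinRegion m N z z' ∩ ω) u a₂ := by
    refine (T2 u huS2).symm.mono ?_
    exact fun v hv => ⟨R2 (hS2 hv).1, (hS2 hv).2⟩
  have W2 : PathIn triGraph (sepJoinRegion m N z z' ∩ ω) a₂ b₃ := by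
    refine Q2.mono ?_
    rintro v ⟨hv | hv, hvω⟩
    exacts [⟨R2 hv, hvω⟩, ⟨hann (R3 hv), hvω⟩]
  have W3 : PathIn triGraph (sepJoinRegion m N z z' ∩ ω) b₃ a₄ := by
    refine Q4.symm.mono ?_
    rintro v ⟨hv | hv, hvω⟩
    exacts [⟨R4 hv, hvω⟩, ⟨hann (R3 hv), hvω⟩]
  have W4 : PathIn triGraph (sepJoinRegion m N z z' ∩ ω) a₄ u' := by
    refine (T4 u' huS4).mono ?_
    exact fun v hv => ⟨R4 (hS4 hv).1, (hS4 hv).2⟩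
  exact ⟨z, z', u, u', mk_mem_sepLanding N, mk_mem_sepLanding m, hIn, hOut, ((W1.trans W2).trans W3).trans W4⟩

/-- **Both arms**: `sepInitArm m N ∩ negFlip ⁻¹' sepInitArm m N ⊆ sepTwoArm m N`. [cite: Nolin2008, §4.3 Prop. 12 (proof) and Prop. 14 (arXiv 0711.4948: Prop. 11, 13)] -/
theorem sepInitArm_inter_subset_sepTwoArm (hm : 1100 ≤ m) (hmN : 2 * m ≤ N) :
    sepInitArm m N ∩ negFlip ⁻¹' sepInitArm m N ⊆ sepTwoArm m N := fun _ h =>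
  ⟨sepInitArm_subset_sepOpenArm hm hmN h.1, sepInitArm_subset_sepOpenArm hm hmN h.2⟩

end Det

/-! ### Probability -/

/-- **RSW and Harris for the explicit arm**: if `c ≤ P_{1/2}(long-way crossing of
[0, 512 n] × [0, n])` for all `n ≥ 1` (`c ≥ 0`), then `P(sepInitArm m N) ≥ c⁵` for `1100 ≤ m`,
`2m ≤ N ≤ 5m`. [cite: Nolin2008, §4.3 Prop. 14 (arXiv 0711.4948: Prop. 13)] -/
theorem le_real_sepInitArm {c : ℝ} (hrsw : ∀ n : ℕ, 1 ≤ ⌊(512 : ℝ) * n⌋₊ → c ≤ triLRCrossingProb half ⌊(512 : ℝ) * n⌋₊ n)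
    (hc : 0 ≤ c) {m N : ℕ} (hm : 1100 ≤ m) (hmN : 2 * m ≤ N) (hN : N ≤ 5 * m) :
    c ^ 5 ≤ (triSitePercolation half).real (sepInitArm m N) := by
  have hfl : ∀ n : ℕ, ⌊(512 : ℝ) * (n : ℕ)⌋₊ = 512 * n := fun n => by
    have : (512 : ℝ) * (n : ℕ) = ((512 * n : ℕ) : ℝ) := by push_cast; ring
    rw [this, Nat.floor_natCast]
  have hcw : ∀ L n : ℕ, 1 ≤ n → L ≤ 512 * n → c ≤ triLRCrossingProb half L n := fun L n hn hL => by
    have h := hrsw n (by rw [hfl]; omega)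
    rw [hfl] at h
    exact h.trans (triLRCrossingProb_anti_width half hL n)
  set F := sepInitArmFinset m N with hF
  set E1 := triVCross ((m : ℤ) - (m / 8 : ℕ) + 1) (-((m / 2 : ℕ) : ℤ) - (m / 64 : ℕ)) (m / 8 - 2) (2 * (m / 64)) with hE1
  set E2 := triHCross ((m : ℤ) - (m / 8 : ℕ) + 1) (-((m / 2 : ℕ) : ℤ)) (N - m + m / 8 - 2) (m / 64) with hE2
  set E3 := triVCross ((N : ℤ) - (N / 8 : ℕ)) (-((N / 2 : ℕ) : ℤ) - (N / 64 : ℕ)) (N / 8 - 1) (N / 2 + N / 64 - m / 2 + m / 64) with hE3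
  set E4 := triHCross ((N : ℤ) - (N / 8 : ℕ)) (-((N / 2 : ℕ) : ℤ) - (N / 64 : ℕ) + 1) (2 * (N / 8) - 1) (N / 64 - 1) with hE4
  set E5 := triVCross ((N : ℤ) + 2) (-((N / 2 : ℕ) : ℤ) - (N / 64 : ℕ)) (N / 8 - 3) (2 * (N / 64)) with hE5
  have c1 : (↑(triStripFinset ((m : ℤ) - (m / 8 : ℕ) + 1) (-((m / 2 : ℕ) : ℤ) - (m / 64 : ℕ)) (m / 8 - 2) (2 * (m / 64))) : Set (Site 2)) ⊆ ↑F :=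
    Finset.coe_subset.2 (Finset.subset_union_left.trans (Finset.subset_union_left.trans
      (Finset.subset_union_left.trans Finset.subset_union_left)))
  have c2 : (↑(triStripFinset ((m : ℤ) - (m / 8 : ℕ) + 1) (-((m / 2 : ℕ) : ℤ)) (N - m + m / 8 - 2) (m / 64)) : Set (Site 2)) ⊆ ↑F :=
    Finset.coe_subset.2 (Finset.subset_union_right.trans (Finset.subset_union_left.trans
      (Finset.subset_union_left.trans Finset.subset_union_left)))
  have c3 : (↑(triStripFinset ((N : ℤ) - (N / 8 : ℕ)) (-((N / 2 : ℕ) : ℤ) - (N / 64 : ℕ)) (N / 8 - 1) (N / 2 + N / 64 - m / 2 + m / 64)) :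
      Set (Site 2)) ⊆ ↑F :=
    Finset.coe_subset.2 (Finset.subset_union_right.trans (Finset.subset_union_left.trans Finset.subset_union_left))
  have c4 : (↑(triStripFinset ((N : ℤ) - (N / 8 : ℕ)) (-((N / 2 : ℕ) : ℤ) - (N / 64 : ℕ) + 1) (2 * (N / 8) - 1) (N / 64 - 1)) : Set (Site 2)) ⊆ ↑F :=
    Finset.coe_subset.2 (Finset.subset_union_right.trans Finset.subset_union_left)
  have c5 : (↑(triStripFinset ((N : ℤ) + 2) (-((N / 2 : ℕ) : ℤ) - (N / 64 : ℕ)) (N / 8 - 3) (2 * (N / 64))) : Set (Site 2)) ⊆ ↑F :=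
    Finset.coe_subset.2 Finset.subset_union_right
  have d1 : DeterminedBy E1 ↑F := (determinedBy_triVCross _ _ _ _).mono c1
  have d2 : DeterminedBy E2 ↑F := (determinedBy_triHCross _ _ _ _).mono c2
  have d3 : DeterminedBy E3 ↑F := (determinedBy_triVCross _ _ _ _).mono c3
  have d4 : DeterminedBy E4 ↑F := (determinedBy_triHCross _ _ _ _).mono c4
  have d5 : DeterminedBy E5 ↑F := (determinedBy_triVCross _ _ _ _).mono c5
  have u1 : IsUpperSet E1 := isUpperSet_triVCross _ _ _ _
  have u2 : IsUpperSet E2 := isUpperSet_triHCross _ _ _ _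
  have u3 : IsUpperSet E3 := isUpperSet_triVCross _ _ _ _
  have u4 : IsUpperSet E4 := isUpperSet_triHCross _ _ _ _
  have u5 : IsUpperSet E5 := isUpperSet_triVCross _ _ _ _
  have e1 : c ≤ (triSitePercolation half).real E1 := by
    rw [hE1, triSitePercolation_real_triVCross]; exact hcw _ _ (by omega) (by omega)
  have e2 : c ≤ (triSitePercolation half).real E2 := by
    rw [hE2, triSitePercolation_real_triHCross]; exact hcw _ _ (by omega) (by omega)
  have e3 : c ≤ (triSitePercolation half).real E3 := by
    rw [hE3, triSitePercolation_real_triVCross]; exact hcw _ _ (by omega) (by omega)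
  have e4 : c ≤ (triSitePercolation half).real E4 := by
    rw [hE4, triSitePercolation_real_triHCross]; exact hcw _ _ (by omega) (by omega)
  have e5 : c ≤ (triSitePercolation half).real E5 := by
    rw [hE5, triSitePercolation_real_triVCross]; exact hcw _ _ (by omega) (by omega)
  have h12 := sitePercolation_harris half d1 d2 u1 u2
  have h123 := sitePercolation_harris half (d1.inter d2) d3 (u1.inter u2) u3
  have h1234 := sitePercolation_harris half ((d1.inter d2).inter d3) d4 ((u1.inter u2).inter u3) u4
  have h12345 := sitePercolation_harris half (((d1.inter d2).inter d3).inter d4) d5 (((u1.inter u2).inter u3).inter u4) u5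
  have hdef : sepInitArm m N = E1 ∩ E2 ∩ E3 ∩ E4 ∩ E5 := rfl
  unfold triSitePercolation at e1 e2 e3 e4 e5 ⊢
  rw [hdef]
  set μ := sitePercolation (Site 2) half with hμ
  have h0 : ∀ s, 0 ≤ μ.real s := fun s => measureReal_nonneg
  calc c ^ 5 = c * c * c * c * c := by ring
    _ ≤ μ.real E1 * μ.real E2 * μ.real E3 * μ.real E4 * μ.real E5 := by
        have := mul_le_mul e1 e2 hc (h0 _)
        have := mul_le_mul this e3 hc (mul_nonneg (h0 _) (h0 _))
        have := mul_le_mul this e4 hc (mul_nonneg (mul_nonneg (h0 _) (h0 _)) (h0 _))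
        exact mul_le_mul this e5 hc (mul_nonneg (mul_nonneg (mul_nonneg (h0 _) (h0 _)) (h0 _)) (h0 _))
    _ ≤ μ.real (E1 ∩ E2) * μ.real E3 * μ.real E4 * μ.real E5 :=
        mul_le_mul_of_nonneg_right (mul_le_mul_of_nonneg_right (mul_le_mul_of_nonneg_right h12 (h0 _)) (h0 _)) (h0 _)
    _ ≤ μ.real (E1 ∩ E2 ∩ E3) * μ.real E4 * μ.real E5 :=
        mul_le_mul_of_nonneg_right (mul_le_mul_of_nonneg_right h123 (h0 _)) (h0 _)
    _ ≤ μ.real (E1 ∩ E2 ∩ E3 ∩ E4) * μ.real E5 := mul_le_mul_of_nonneg_right h1234 (h0 _)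
    _ ≤ μ.real (E1 ∩ E2 ∩ E3 ∩ E4 ∩ E5) := h12345

/-- **The landed two-arm event at bounded ratio**: if `c ≤ P_{1/2}(long-way crossing of
[0, 512 n] × [0, n])` for all `n ≥ 1` (`c ≥ 0`), then `P(sepTwoArm m N) ≥ (c⁵)²` for `1100 ≤ m`,
`2m ≤ N ≤ 5m`: the explicit open arm and its `negFlip` image are independent (determined by the
right, resp. left, open half-plane) and equiprobable (`negFlip`-invariance of `P_{1/2}`). [cite: Nolin2008, §4.3 Prop. 14 (arXiv 0711.4948: Prop. 13)] -/
theorem sq_le_real_sepTwoArm {c : ℝ} (hrsw : ∀ n : ℕ, 1 ≤ ⌊(512 : ℝ) * n⌋₊ → c ≤ triLRCrossingProb half ⌊(512 : ℝ) * n⌋₊ n)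
    (hc : 0 ≤ c) {m N : ℕ} (hm : 1100 ≤ m) (hmN : 2 * m ≤ N) (hN : N ≤ 5 * m) :
    (c ^ 5) ^ 2 ≤ (triSitePercolation half).real (sepTwoArm m N) := by
  classical
  have d := determinedBy_sepInitArm m N
  have d' : DeterminedBy (negFlip ⁻¹' sepInitArm m N) ↑((sepInitArmFinset m N).image (fun v : Site 2 => -v)) := by
    refine d.preimage_negFlip.mono ?_
    intro v hv
    rw [Finset.coe_image]
    exact ⟨-v, hv, neg_neg v⟩
  have hdisj : Disjoint (sepInitArmFinset m N) ((sepInitArmFinset m N).image (fun v : Site 2 => -v)) := by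
    rw [Finset.disjoint_left]
    intro v hv hv'
    rw [Finset.mem_image] at hv'
    obtain ⟨w, hw, rfl⟩ := hv'
    have h1 := sepInitArmFinset_pos (by omega) hmN hv
    have h2 := sepInitArmFinset_pos (by omega) hmN hw
    simp only [Pi.neg_apply] at h1
    omega
  have hind := sitePercolation_real_inter_of_disjoint half d d' hdisj
  have hneg := triSitePercolation_real_preimage_negFlip (sepInitArm m N)
  have h5 := le_real_sepInitArm hrsw hc hm hmN hN
  unfold triSitePercolation at hind hneg h5 ⊢
  calc (c ^ 5) ^ 2 = c ^ 5 * c ^ 5 := sq _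
    _ ≤ (sitePercolation (Site 2) half).real (sepInitArm m N) * (sitePercolation (Site 2) half).real (negFlip ⁻¹' sepInitArm m N) := by
        rw [hneg]; exact mul_le_mul h5 h5 (pow_nonneg hc _) measureReal_nonneg
    _ = (sitePercolation (Site 2) half).real (sepInitArm m N ∩ negFlip ⁻¹' sepInitArm m N) := hind.symm
    _ ≤ (sitePercolation (Site 2) half).real (sepTwoArm m N) :=
        measureReal_mono (sepInitArm_inter_subset_sepTwoArm hm hmN) (measure_ne_top _ _)

/-- **The initial estimate of the scheme**: there is `c_init > 0` with
`P(sepTwoArm m N) ≥ c_init` for all `1100 ≤ m`, `2m ≤ N ≤ 5m` (`tri_rsw_half_holds` at aspect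
ratio `512`). [cite: Nolin2008, §4.3 Prop. 14 (arXiv 0711.4948: Prop. 13); §4.4 (proof of Thm. 11)] -/
theorem exists_le_real_sepTwoArm :
    ∃ c : ℝ, 0 < c ∧ ∀ m N : ℕ, 1100 ≤ m → 2 * m ≤ N → N ≤ 5 * m → c ≤ (triSitePercolation half).real (sepTwoArm m N) := by
  obtain ⟨c, hc, hrsw⟩ := tri_rsw_half_holds 512 (by norm_num)
  exact ⟨(c ^ 5) ^ 2, by positivity, fun m N hm hmN hN => sq_le_real_sepTwoArm (fun n hn => (hrsw n hn).1) hc.le hm hmN hN⟩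

end Literature.Probability.Percolation
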